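import Summits.Ventures.PackingBounds.Energy.FivePointRieszThreeBridge
import Summits.Ventures.PackingBounds.Energy.GramPSDMargin
import HarnessLib

/-!
# Riesz `s = 3`, five points, `d = 6`: the 77 × 77 Gram block is STRICTLY positive definite with a kernel-checked margin

Framing: lottery ticket; floor = certified bounds/negative ranges. Venture `PackingBounds`, cell
`pub-packcert`, energy family E3PT (pub-packcert-energy gen 12; KERNEL-D6 route, first use of `GramPSDMargin`).

The same integer data `S·Mp = L Lᵀ + E` (`FivePointRieszThreeGramData*`) carries a diagonal-dominance margin:
`Σ_j |E_ij| + 2M ≤ 2 E_ii` with `M = 4·10²⁶` (`decide +kernel`, `GramData.checkDDm`), hence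
`(M/S) · Σ_{i<77} y_i² ≤ quad_1R3 y` (`M/S ≈ 1.05·10⁻⁴`): the explicit `ℚ(√2,√3)`-valued Gram form of the
certificate `e3pt-sharp-n3N5s3d6K-none.json` is positive DEFINITE, quantitatively. (Use: complementary
slackness `slack(u,v,t) = 0 ⇒` every face-basis polynomial vanishes at `(u,v,t)`.)
-/

noncomputable section

namespace Summit.Ventures.PackingBounds.Energy.RieszThreeD6

open Summit.Ventures.PackingBounds.Energy.GramData

set_option maxRecDepth 100000 in
/-- Diagonal dominance of `E` with margin `M = 4·10²⁶` for all 77 rows (kernel evaluation). -/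
theorem ddmQ_all : checkDDm 77 400000000000000000000000000 eQ = true := by decide +kernel

end Summit.Ventures.PackingBounds.Energy.RieszThreeD6

namespace Summit.Ventures.PackingBounds.Energy.FivePointRieszThree

open Finset Summit.Ventures.PackingBounds.Energy.GramData Summit.Ventures.PackingBounds.Energy.RieszThreeD6

set_option maxRecDepth 100000 in
/-- **Strict positive definiteness of the 77 × 77 Gram block:** `(M/S) · Σ_{i<77} y_i² ≤ quad_1R3 y` with
`M = 4·10²⁶`, `S = scaleQ` (`M/S ≈ 1.05·10⁻⁴`). -/
theorem quad_1_marginR3 (y : ℕ → ℝ) :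
    ((400000000000000000000000000 : ℝ) / (scaleQ : ℝ)) * ∑ i ∈ range 77, y i ^ 2 ≤ quad_1R3 y := by
  have hS : (0 : ℝ) < (scaleQ : ℝ) := by unfold scaleQ; norm_num
  have hlen : yQ.length = 77 := by decide
  have hrow : ∀ m, m < 77 → (yQ.getD m []).length = 77 := by decide +kernel
  have h := pd_of_checks_margin 77 77 400000000000000000000000000 yQ lQ eQ rowsQ_all (of_checkDDm ddmQ_all)
    (fun i : Fin 77 => y i)
  rw [← listQuad_eq_sum_ent y yQ 77 hlen hrow, Fin.sum_univ_eq_sum_range (fun i => y i ^ 2) 77] at h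
  push_cast at h
  have hpk := pk_1_nonnegR3 y
  have hb := quad_bridgeR3 y
  have h2 : (400000000000000000000000000 : ℝ) * ∑ i ∈ range 77, y i ^ 2 ≤ (scaleQ : ℝ) * quad_1R3 y := by
    rw [hb]; nlinarith [mul_nonneg hS.le hpk]
  rw [div_mul_eq_mul_div, div_le_iff₀ hS]
  linarith [h2]

end Summit.Ventures.PackingBounds.Energy.FivePointRieszThree
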